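import Summits.HubbardSuperconductivity.HubbardSuperconductivity.Theorems.CooperPairDMottWalkCooperPairDMottPairTrialCeilingLocality

/-!
# Route `CooperPairDMottWalk`, crux `CooperPairDMott` (stmt-HubbardSuperconductivity-1177):
# the block product vector (a non-zero simultaneous eigenvector of all embedded even observables)

Support file for the stub `stub_pairTrialCeiling`. The variational UPPER bound on the half-filled
energy of the breathing torus uses the "product of plaquette ground states". With Jordan–Wigner
matrices the honest construction is the ordered product `L = ∏_j (f_j)_* |σ⟩⟨σ|` of the embedded
rank-one projections of a unit vector `σ` of the small system over a family of order embeddings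
`f_j : Λ ↪o Λ'` with pairwise disjoint ranges, applied to a basis vector. This file proves, for such
a family (`exists_blockProduct_vector`): there is `Ω₀ ≠ 0` in the big Fock space such that for EVERY
even observable `O` of the small system with `O σ = c σ`, `(Σ_j (f_j)_* O) Ω₀ = (|T| c) Ω₀`.
Ingredients: embedded even observables of one block commute with the projections of the other blocks
(graded locality) and multiply their own to `c` (`mul_list_prod_eq_smul`, `sum_mul_list_prod_eq_smul`);
the product is non-zero because its trace factorises over the disjoint CAR subalgebras
(`trace_list_prod_jwEmbed_ne_zero`, the tree's `trace_mul_of_mem_carSubalgebra` and `trace_jwEmbed`).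
Also the block sums of the embedded spin-resolved numbers (`sum_jwEmbed_numberOp_eq`,
`sum_jwEmbed_totalNumber_eq_of_cover`, `sum_jwEmbed_spinZ_eq_of_cover`).

References: O. Bratteli, D. W. Robinson II (1997) §5.2.2 (product states on the CAR algebra; the
trace is a product state); H. Tasaki (2020) §9.2. All statements are [folklore]; no definition is
introduced.
-/

set_option linter.dupNamespace false

noncomputable section

namespace Summit.HubbardSuperconductivity.HubbardSuperconductivity.Theorems.CooperPairDMottWalk

open Matrix Finset Literature.MathematicalPhysics.QuantumLattice
open scoped ComplexOrder

/-! ### Inserting a commuting operator into an ordered product -/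

section ListProduct

variable {N : Type*} [Fintype N] [DecidableEq N] {J : Type*}

/-- If `X` commutes with the factors `P j'`, `j' ≠ j`, of an ordered product containing `P j`, and
`X (P j) = E (P j)`, then `X ∏ = E ∏`. [folklore] -/
theorem mul_list_prod_eq_smul (X : Matrix N N ℂ) (P : J → Matrix N N ℂ) (j : J) (E : ℂ)
    (hj : X * P j = E • P j) :
    ∀ l : List J, j ∈ l → (∀ j' ∈ l, j' ≠ j → X * P j' = P j' * X) →
      X * (l.map P).prod = E • (l.map P).prod
  | [], h, _ => absurd h List.not_mem_nil
  | (j' :: l), h, hcomm => by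
      rw [List.map_cons, List.prod_cons]
      by_cases hjj : j' = j
      · subst hjj
        rw [← Matrix.mul_assoc, hj, smul_mul_assoc]
      · have hmem : j ∈ l := (List.mem_cons.1 h).resolve_left (Ne.symm hjj)
        have htail : ∀ j'' ∈ l, j'' ≠ j → X * P j'' = P j'' * X :=
          fun j'' hj'' hne => hcomm j'' (List.mem_cons_of_mem _ hj'') hne
        rw [← Matrix.mul_assoc, hcomm j' List.mem_cons_self hjj, Matrix.mul_assoc,
          mul_list_prod_eq_smul X P j E hj l hmem htail, mul_smul_comm]

/-- Summing `mul_list_prod_eq_smul` over a finset of insertions: `(Σ_{j ∈ T} X_j) ∏ = (|T| E) ∏`.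
[folklore] -/
theorem sum_mul_list_prod_eq_smul (T : Finset J) (X P : J → Matrix N N ℂ) (E : ℂ) (l : List J)
    (hl : ∀ j ∈ T, j ∈ l) (hcomm : ∀ j ∈ T, ∀ j' ∈ l, j' ≠ j → X j * P j' = P j' * X j)
    (hj : ∀ j ∈ T, X j * P j = E • P j) :
    (∑ j ∈ T, X j) * (l.map P).prod = ((T.card : ℂ) * E) • (l.map P).prod := by
  rw [Finset.sum_mul, Finset.sum_congr rfl fun j hjT => mul_list_prod_eq_smul (X j) P j E (hj j hjT) l (hl j hjT)
    (hcomm j hjT), Finset.sum_const, ← Nat.cast_smul_eq_nsmul ℂ, smul_smul]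

omit [DecidableEq N] in
/-- A non-zero matrix has a non-zero column: `M ≠ 0 ⟹ ∃ s, M e_s ≠ 0`. [folklore] -/
theorem exists_mulVec_single_ne_zero [DecidableEq N] {M : Matrix N N ℂ} (hM : M ≠ 0) :
    ∃ s : N, M *ᵥ Pi.single s 1 ≠ 0 := by
  by_contra h
  rw [not_exists] at h
  apply hM
  ext i s
  have hs := not_not.1 (h s)
  rw [mulVec_single_one] at hs
  exact congr_fun hs i

end ListProduct

/-! ### The trace of an ordered product of block operators factorises -/

section Trace

variable {Λ Λ' : Type*} [LinearOrder Λ] [Fintype Λ] [LinearOrder Λ'] [Fintype Λ'] {J : Type*} [DecidableEq J]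

/-- An ordered product of embedded block operators lies in the CAR subalgebra of the union of the
blocks. [cite: BratteliRobinsonII1997, §5.2.2] -/
theorem list_prod_jwEmbed_mem_carSubalgebra (f : J → Λ ↪o Λ') (a : J → Matrix (Finset (Orb Λ)) (Finset (Orb Λ)) ℂ)
    (l : List J) :
    (l.map fun j => jwEmbed (orbEmb (f j)) (a j)).prod ∈
      carSubalgebra (l.toFinset.biUnion fun j => orbs ((Finset.univ : Finset Λ).map (f j).toEmbedding)) := by
  refine Subalgebra.list_prod_mem _ fun x hx => ?_
  obtain ⟨j, hj, rfl⟩ := List.mem_map.1 hx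
  exact carSubalgebra_mono (Finset.subset_biUnion_of_mem (fun j => orbs ((Finset.univ : Finset Λ).map (f j).toEmbedding))
    (List.mem_toFinset.2 hj)) (jwEmbed_mem_carSubalgebra_orbs (f j) (a j))

/-- **The trace of an ordered product of block operators over disjoint blocks is non-zero when every
factor has non-zero trace** (the normalised trace is a product state on the CAR algebra).
[cite: BratteliRobinsonII1997, §5.2.2] -/
theorem trace_list_prod_jwEmbed_ne_zero (f : J → Λ ↪o Λ') (a : J → Matrix (Finset (Orb Λ)) (Finset (Orb Λ)) ℂ) :
    ∀ l : List J, l.Nodup →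
      (∀ j ∈ l, ∀ j' ∈ l, j ≠ j' →
        Disjoint ((Finset.univ : Finset Λ).map (f j).toEmbedding) ((Finset.univ : Finset Λ).map (f j').toEmbedding)) →
      (∀ j ∈ l, (a j).trace ≠ 0) →
      ((l.map fun j => jwEmbed (orbEmb (f j)) (a j)).prod).trace ≠ 0
  | [], _, _, _ => by
      rw [List.map_nil, List.prod_nil, trace_one, Nat.cast_ne_zero]
      exact Fintype.card_ne_zero
  | (j :: l), hnd, hdisj, ha => by
      rw [List.nodup_cons] at hnd
      rw [List.map_cons, List.prod_cons]
      have hA := jwEmbed_mem_carSubalgebra_orbs (f j) (a j)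
      have hB := list_prod_jwEmbed_mem_carSubalgebra f a l
      have hS : Disjoint (orbs ((Finset.univ : Finset Λ).map (f j).toEmbedding))
          (l.toFinset.biUnion fun j => orbs ((Finset.univ : Finset Λ).map (f j).toEmbedding)) := by
        rw [Finset.disjoint_biUnion_right]
        intro j' hj'
        have hj'l : j' ∈ l := List.mem_toFinset.1 hj'
        refine disjoint_orbs (hdisj j List.mem_cons_self j' (List.mem_cons_of_mem _ hj'l) ?_)
        rintro rfl
        exact hnd.1 hj'l
      have key := trace_mul_of_mem_carSubalgebra hA hB hS
      have htail := trace_list_prod_jwEmbed_ne_zero f a l hnd.2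
        (fun i hi i' hi' hne => hdisj i (List.mem_cons_of_mem _ hi) i' (List.mem_cons_of_mem _ hi') hne)
        (fun i hi => ha i (List.mem_cons_of_mem _ hi))
      have hhead : (jwEmbed (orbEmb (f j)) (a j)).trace ≠ 0 := by
        rw [trace_jwEmbed]
        exact mul_ne_zero (pow_ne_zero _ two_ne_zero) (ha j List.mem_cons_self)
      intro h0
      rw [h0, zero_mul] at key
      exact mul_ne_zero hhead htail key.symm

end Trace

/-! ### The block product vector -/

section Product

variable {Λ Λ' : Type*} [LinearOrder Λ] [Fintype Λ] [LinearOrder Λ'] [Fintype Λ'] {J : Type*} [DecidableEq J]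

/-- **The block product vector.** For order embeddings `f_j : Λ ↪o Λ'`, `j ∈ T`, with pairwise disjoint
ranges and a unit vector `σ` of the small Fock space there is a non-zero vector `Ω₀` of the big Fock space
which is a simultaneous eigenvector of every block sum of an embedded EVEN observable having `σ` as an
eigenvector: `O σ = c σ ⟹ (Σ_{j ∈ T} (f_j)_* O) Ω₀ = (|T| c) Ω₀`. (`Ω₀ = (∏_j (f_j)_* |σ⟩⟨σ|) e_s` for a
suitable basis vector.) [cite: BratteliRobinsonII1997, §5.2.2] -/
theorem exists_blockProduct_vector (T : Finset J) (f : J → Λ ↪o Λ')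
    (hdisj : ∀ j ∈ T, ∀ j' ∈ T, j ≠ j' →
      Disjoint ((Finset.univ : Finset Λ).map (f j).toEmbedding) ((Finset.univ : Finset Λ).map (f j').toEmbedding))
    {σ : Fock (Orb Λ)} (hσ1 : star σ ⬝ᵥ σ = 1) :
    ∃ Ω₀ : Fock (Orb Λ'), Ω₀ ≠ 0 ∧
      ∀ (O : Matrix (Finset (Orb Λ)) (Finset (Orb Λ)) ℂ) (c : ℂ),
        O ∈ carEvenSubalgebra (Finset.univ : Finset (Orb Λ)) → O *ᵥ σ = c • σ →
          (∑ j ∈ T, jwEmbed (orbEmb (f j)) O) *ᵥ Ω₀ = ((T.card : ℂ) * c) • Ω₀ := by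
  classical
  set P : J → Matrix (Finset (Orb Λ')) (Finset (Orb Λ')) ℂ :=
    fun j => jwEmbed (orbEmb (f j)) (vecMulVec σ (star σ)) with hP
  set l := T.toList with hl
  set Lp := (l.map P).prod with hLp
  -- the product is non-zero: its trace factorises
  have htr : Lp.trace ≠ 0 := by
    have h := trace_list_prod_jwEmbed_ne_zero f (fun _ => vecMulVec σ (star σ)) l (Finset.nodup_toList T)
      (fun j hj j' hj' hne => hdisj j (Finset.mem_toList.1 hj) j' (Finset.mem_toList.1 hj') hne)
      (fun j _ => by
        rw [trace_vecMulVec, dotProduct_comm, hσ1]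
        exact one_ne_zero)
    exact h
  have hLp0 : Lp ≠ 0 := fun h => htr (by rw [h, trace_zero])
  obtain ⟨s, hs⟩ := exists_mulVec_single_ne_zero hLp0
  refine ⟨Lp *ᵥ Pi.single s 1, hs, fun O c hO hOσ => ?_⟩
  -- insertions
  have hcomm : ∀ j ∈ T, ∀ j' ∈ l, j' ≠ j → jwEmbed (orbEmb (f j)) O * P j' = P j' * jwEmbed (orbEmb (f j)) O := by
    intro j hj j' hj' hne
    exact (commute_jwEmbed_jwEmbed (hdisj j hj j' (Finset.mem_toList.1 hj') (Ne.symm hne)) hO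
      (vecMulVec σ (star σ))).eq
  have hown : ∀ j ∈ T, jwEmbed (orbEmb (f j)) O * P j = c • P j := by
    intro j _
    rw [hP]
    dsimp only
    rw [← map_mul, mul_vecMulVec, hOσ, smul_vecMulVec, jwEmbed_apply, jwEmbed_apply, JWEmbed.embedFun_smul]
  have key := sum_mul_list_prod_eq_smul T (fun j => jwEmbed (orbEmb (f j)) O) P c l
    (fun j hj => Finset.mem_toList.2 hj) hcomm hown
  rw [mulVec_mulVec, hLp, key, smul_mulVec]

end Product

/-! ### Block sums of the embedded spin-resolved particle numbers -/

section Numbers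

variable {Λ Λ' : Type*} [LinearOrder Λ] [Fintype Λ] [LinearOrder Λ'] [Fintype Λ'] {J : Type*}

/-- **Block sums of embedded number operators**: if the ranges of the `f_j`, `j ∈ T`, are pairwise
disjoint and cover `Λ'`, then `Σ_{j ∈ T} (f_j)_* (Σ_x n_{xτ}) = Σ_{x'} n_{x'τ}`. [folklore] -/
theorem sum_jwEmbed_numberOp_eq (T : Finset J) (f : J → Λ ↪o Λ')
    (hdisj : ∀ j ∈ T, ∀ j' ∈ T, j ≠ j' →
      Disjoint ((Finset.univ : Finset Λ).map (f j).toEmbedding) ((Finset.univ : Finset Λ).map (f j').toEmbedding))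
    (hcover : T.biUnion (fun j => (Finset.univ : Finset Λ).map (f j).toEmbedding) = Finset.univ) (τ : Fin 2) :
    ∑ j ∈ T, jwEmbed (orbEmb (f j)) (∑ x : Λ, numberOp x τ) = ∑ x' : Λ', numberOp x' τ := by
  classical
  have h1 : ∀ j, jwEmbed (orbEmb (f j)) (∑ x : Λ, numberOp x τ) =
      ∑ x' ∈ (Finset.univ : Finset Λ).map (f j).toEmbedding, numberOp x' τ := by
    intro j
    rw [map_sum, Finset.sum_map]
    exact Finset.sum_congr rfl fun x _ => jwEmbed_numberOp (f j) x τ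
  rw [Finset.sum_congr rfl fun j _ => h1 j, ← Finset.sum_biUnion (fun j hj j' hj' hne => hdisj j hj j' hj' hne), hcover]

/-- `N = Σ_τ Σ_x n_{xτ}`. [folklore] -/
theorem totalNumber_eq_sum_sum (Λ₀ : Type*) [LinearOrder Λ₀] [Fintype Λ₀] :
    (totalNumber : Matrix (Finset (Orb Λ₀)) (Finset (Orb Λ₀)) ℂ) = ∑ τ : Fin 2, ∑ x : Λ₀, numberOp x τ := by
  rw [totalNumber, Finset.sum_comm]

/-- `S^z = ½ (Σ_x n_{x↑} − Σ_x n_{x↓})`. [folklore] -/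
theorem spinZ_eq_half_smul_sub (Λ₀ : Type*) [LinearOrder Λ₀] [Fintype Λ₀] :
    (HubbardWave0.spinZ : Matrix (Finset (Orb Λ₀)) (Finset (Orb Λ₀)) ℂ) =
      (1 / 2 : ℂ) • ((∑ x : Λ₀, numberOp x 0) - ∑ x : Λ₀, numberOp x 1) := by
  rw [HubbardWave0.spinZ, Finset.sum_sub_distrib]

/-- Block sums of the embedded total numbers: `Σ_j (f_j)_* N = N`. [folklore] -/
theorem sum_jwEmbed_totalNumber_eq_of_cover (T : Finset J) (f : J → Λ ↪o Λ')
    (hdisj : ∀ j ∈ T, ∀ j' ∈ T, j ≠ j' →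
      Disjoint ((Finset.univ : Finset Λ).map (f j).toEmbedding) ((Finset.univ : Finset Λ).map (f j').toEmbedding))
    (hcover : T.biUnion (fun j => (Finset.univ : Finset Λ).map (f j).toEmbedding) = Finset.univ) :
    ∑ j ∈ T, jwEmbed (orbEmb (f j)) (totalNumber : Matrix (Finset (Orb Λ)) (Finset (Orb Λ)) ℂ) =
      (totalNumber : Matrix (Finset (Orb Λ')) (Finset (Orb Λ')) ℂ) := by
  rw [totalNumber_eq_sum_sum Λ, totalNumber_eq_sum_sum Λ',
    Finset.sum_congr rfl fun j _ => map_sum (jwEmbed (orbEmb (f j))) _ _, Finset.sum_comm]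
  exact Finset.sum_congr rfl fun τ _ => sum_jwEmbed_numberOp_eq T f hdisj hcover τ

/-- Block sums of the embedded `S^z`: `Σ_j (f_j)_* S^z = S^z`. [folklore] -/
theorem sum_jwEmbed_spinZ_eq_of_cover (T : Finset J) (f : J → Λ ↪o Λ')
    (hdisj : ∀ j ∈ T, ∀ j' ∈ T, j ≠ j' →
      Disjoint ((Finset.univ : Finset Λ).map (f j).toEmbedding) ((Finset.univ : Finset Λ).map (f j').toEmbedding))
    (hcover : T.biUnion (fun j => (Finset.univ : Finset Λ).map (f j).toEmbedding) = Finset.univ) :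
    ∑ j ∈ T, jwEmbed (orbEmb (f j)) (HubbardWave0.spinZ : Matrix (Finset (Orb Λ)) (Finset (Orb Λ)) ℂ) =
      (HubbardWave0.spinZ : Matrix (Finset (Orb Λ')) (Finset (Orb Λ')) ℂ) := by
  have h1 : ∀ j, jwEmbed (orbEmb (f j)) (HubbardWave0.spinZ : Matrix (Finset (Orb Λ)) (Finset (Orb Λ)) ℂ) =
      (1 / 2 : ℂ) • (jwEmbed (orbEmb (f j)) (∑ x : Λ, numberOp x 0) - jwEmbed (orbEmb (f j)) (∑ x : Λ, numberOp x 1)) := by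
    intro j
    rw [spinZ_eq_half_smul_sub Λ, jwEmbed_apply, JWEmbed.embedFun_smul, ← jwEmbed_apply, map_sub]
  rw [Finset.sum_congr rfl fun j _ => h1 j, ← Finset.smul_sum, Finset.sum_sub_distrib,
    sum_jwEmbed_numberOp_eq T f hdisj hcover 0, sum_jwEmbed_numberOp_eq T f hdisj hcover 1,
    ← spinZ_eq_half_smul_sub Λ']

end Numbers

/-! ### Registered form -/

/-- **Registered sub-goal `pairTrialCeiling_blockProductVector`** (closed form, as registered on the
crux item): the block product vector of a unit `σ` over a family of order embeddings with pairwise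
disjoint ranges is non-zero and is a simultaneous eigenvector of all block sums of embedded even
observables having `σ` as an eigenvector. [cite: BratteliRobinsonII1997, §5.2.2] -/
theorem pairTrialCeiling_blockProductVector : ∀ {Λ Λ' : Type} [LinearOrder Λ] [Fintype Λ] [LinearOrder Λ'] [Fintype Λ'] {J : Type} [DecidableEq J] (T : Finset J) (f : J → Λ ↪o Λ'), (∀ j ∈ T, ∀ j' ∈ T, j ≠ j' → Disjoint ((Finset.univ : Finset Λ).map (f j).toEmbedding) ((Finset.univ : Finset Λ).map (f j').toEmbedding)) → ∀ {σ : Fock (Orb Λ)}, star σ ⬝ᵥ σ = 1 → ∃ Ω₀ : Fock (Orb Λ'), Ω₀ ≠ 0 ∧ ∀ (O : Matrix (Finset (Orb Λ)) (Finset (Orb Λ)) ℂ) (c : ℂ), O ∈ carEvenSubalgebra (Finset.univ : Finset (Orb Λ)) → O *ᵥ σ = c • σ → (∑ j ∈ T, jwEmbed (orbEmb (f j)) O) *ᵥ Ω₀ = ((T.card : ℂ) * c) • Ω₀ :=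
  fun T f hdisj _ hσ1 => exists_blockProduct_vector T f hdisj hσ1

end Summit.HubbardSuperconductivity.HubbardSuperconductivity.Theorems.CooperPairDMottWalk

end
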